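import Summits.QuantumAdvantage.AdviceFreeQNC0.AffBells22HardcoreWords
import HarnessLib

/-!
# Cell qa-qnc0 — weighted linear hard-core words with a GENERAL light weight `η ∈ [0,2]` (prover qn-prover-3 g25)

`AffBells22HardcoreWords` bounds `S_n(w) = Σ_{v : no two adjacent zeros} Π_{v_i = 0} w_i` by the quadratic potential
`qf A B = 5A² + 2AB + 2B²` with the one-step factors `4` (`w ≤ 2`), `13/4` (`w ≤ 1`), `19/5` (`w ≤ 7/4`).  The degree bounds of
Viola–Wigderson type (`JuntaSizeTwist39`) produce light weights `2·exp(−3/(8·4^d))` arbitrarily close to `2`, so this file adds the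
one-step factor for a general light weight:

* `qf_step_gen` — `qf(A+B, wA) ≤ (3 + η/2)·qf(A,B)` for `0 ≤ w ≤ η ≤ 2` (`4(1+η)·[(3+η/2)qf − qf'] = (2(1+η)B − (4+η)A)² +
  (2−η)(8η²+23η+12)A²`);
* `qf_endSum_le_gen` — weights `≤ 2`, and `≤ η` on `L`: `qf(A_j,B_j) ≤ 17·4^j·((6+η)/8)^{#(L ∩ [1,j])}`;
* **`total_le_two_gen`** — `S ≤ 5·((14+η)/16)^{#(L ∩ [1,j])}·2^j` over words of length `j+1` (`(6+η)/8 ≤ ((14+η)/16)²`).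

WHAT THIS IS NOT: no cyclic identity, no cell statement.
-/

namespace Summit.QuantumAdvantage.AdviceFreeQNC0

open Finset

namespace AffBells22

/-- **One step with a general light weight**: `qf(A+B, wA) ≤ (3 + η/2)·qf(A,B)` for `0 ≤ w ≤ η ≤ 2`, `A, B ≥ 0`. -/
theorem qf_step_gen {A B w η : ℝ} (hA : 0 ≤ A) (hB : 0 ≤ B) (hw : 0 ≤ w) (hwη : w ≤ η) (hη2 : η ≤ 2) :
    qf (A + B) (w * A) ≤ (3 + η / 2) * qf A B := by
  refine (qf_step_mono hA hB hw hwη).trans ?_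
  have hη0 : 0 ≤ η := hw.trans hwη
  have key : 4 * (1 + η) * ((3 + η / 2) * qf A B - qf (A + B) (η * A))
      = (2 * (1 + η) * B - (4 + η) * A) ^ 2 + (2 - η) * (8 * η ^ 2 + 23 * η + 12) * A ^ 2 := by
    unfold qf; ring
  have hpos : 0 < 4 * (1 + η) := by linarith
  have hrhs : 0 ≤ (2 * (1 + η) * B - (4 + η) * A) ^ 2 + (2 - η) * (8 * η ^ 2 + 23 * η + 12) * A ^ 2 := by
    have h1 : 0 ≤ (2 - η) * (8 * η ^ 2 + 23 * η + 12) * A ^ 2 :=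
      mul_nonneg (mul_nonneg (by linarith) (by positivity)) (sq_nonneg A)
    positivity
  have hdiff : 0 ≤ (3 + η / 2) * qf A B - qf (A + B) (η * A) := by
    by_contra hlt
    have : 4 * (1 + η) * ((3 + η / 2) * qf A B - qf (A + B) (η * A)) < 0 :=
      mul_neg_of_pos_of_neg hpos (not_le.mp hlt)
    linarith
  linarith

/-- **Potential bound along the word**, general light weight: weights `0 ≤ w_i ≤ 2` everywhere and `≤ η` on `L` (`0 ≤ η ≤ 2`):
`qf(A_j, B_j) ≤ 17 · 4^j · ((6+η)/8)^{#{i ∈ L : 1 ≤ i ≤ j}}`. -/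
theorem qf_endSum_le_gen (w : ℕ → ℝ) (hw0 : ∀ i, 0 ≤ w i) (hw2 : ∀ i, w i ≤ 2) (L : Finset ℕ) {η : ℝ}
    (hη0 : 0 ≤ η) (hη2 : η ≤ 2) (hL : ∀ i ∈ L, w i ≤ η) (j : ℕ) :
    qf (endSum w j true) (endSum w j false)
      ≤ 17 * 4 ^ j * ((6 + η) / 8 : ℝ) ^ (L.filter fun i => 1 ≤ i ∧ i ≤ j).card := by
  induction j with
  | zero =>
    obtain ⟨h1, h2⟩ := endSum_zero w
    rw [h1, h2]
    have hc : (L.filter fun i => 1 ≤ i ∧ i ≤ 0).card = 0 := by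
      rw [Finset.card_eq_zero, Finset.filter_eq_empty_iff]
      intro i _ h; omega
    rw [hc, pow_zero, pow_zero, mul_one, mul_one]
    unfold qf
    nlinarith [hw0 0, hw2 0]
  | succ j ih =>
    rw [endSum_succ_true, endSum_succ_false]
    have hA := endSum_nonneg hw0 j true
    have hB := endSum_nonneg hw0 j false
    have hτ0 : (0 : ℝ) ≤ (6 + η) / 8 := by positivity
    by_cases hmem : (j + 1) ∈ L
    · have hcard : (L.filter fun i => 1 ≤ i ∧ i ≤ j + 1).card = (L.filter fun i => 1 ≤ i ∧ i ≤ j).card + 1 := by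
        have : (L.filter fun i => 1 ≤ i ∧ i ≤ j + 1) = insert (j + 1) (L.filter fun i => 1 ≤ i ∧ i ≤ j) := by
          ext i
          simp only [mem_filter, mem_insert]
          constructor
          · rintro ⟨hi, h1, h2⟩
            by_cases h : i = j + 1
            · exact Or.inl h
            · exact Or.inr ⟨hi, h1, by omega⟩
          · rintro (h | ⟨hi, h1, h2⟩)
            · subst h; exact ⟨hmem, by omega, le_rfl⟩
            · exact ⟨hi, h1, by omega⟩
        rw [this, card_insert_of_notMem (by simp)]
      rw [hcard, pow_succ, pow_succ]
      have hstep := qf_step_gen hA hB (hw0 (j + 1)) (hL _ hmem) hη2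
      have hq0 := qf_nonneg (endSum w j true) (endSum w j false)
      have hpow : (0 : ℝ) ≤ ((6 + η) / 8 : ℝ) ^ (L.filter fun i => 1 ≤ i ∧ i ≤ j).card := pow_nonneg hτ0 _
      have e : (3 + η / 2 : ℝ) = 4 * ((6 + η) / 8) := by ring
      rw [e] at hstep
      calc qf (endSum w j true + endSum w j false) (w (j + 1) * endSum w j true)
          ≤ 4 * ((6 + η) / 8) * qf (endSum w j true) (endSum w j false) := hstep
        _ ≤ 4 * ((6 + η) / 8) * (17 * 4 ^ j * ((6 + η) / 8 : ℝ) ^ (L.filter fun i => 1 ≤ i ∧ i ≤ j).card) :=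
            mul_le_mul_of_nonneg_left ih (by positivity)
        _ = 17 * (4 ^ j * 4) * (((6 + η) / 8 : ℝ) ^ (L.filter fun i => 1 ≤ i ∧ i ≤ j).card * ((6 + η) / 8)) := by ring
    · have hcard : (L.filter fun i => 1 ≤ i ∧ i ≤ j + 1).card = (L.filter fun i => 1 ≤ i ∧ i ≤ j).card := by
        congr 1
        ext i
        simp only [mem_filter]
        constructor
        · rintro ⟨hi, h1, h2⟩
          have : i ≠ j + 1 := fun h => hmem (h ▸ hi)
          exact ⟨hi, h1, by omega⟩
        · rintro ⟨hi, h1, h2⟩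
          exact ⟨hi, h1, by omega⟩
      rw [hcard, pow_succ]
      have hstep := qf_step_two hA hB (hw0 (j + 1)) (hw2 (j + 1))
      have hpow : (0 : ℝ) ≤ ((6 + η) / 8 : ℝ) ^ (L.filter fun i => 1 ≤ i ∧ i ≤ j).card := pow_nonneg hτ0 _
      nlinarith [hstep, ih, qf_nonneg (endSum w j true) (endSum w j false), hpow]

/-- **Weights `≤ 2`, and `≤ η` on the (ℕ-coded) set `L`** (`0 ≤ η ≤ 2`): `S ≤ 5 · ((14+η)/16)^{#L'} · 2^j` over words of length
`j+1`, `L' = L ∩ [1, j]` (since `(6+η)/8 ≤ ((14+η)/16)²`, the difference being `(2−η)²/256`). -/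
theorem total_le_two_gen (w : ℕ → ℝ) (hw0 : ∀ i, 0 ≤ w i) (hw2 : ∀ i, w i ≤ 2) (L : Finset ℕ) {η : ℝ}
    (hη0 : 0 ≤ η) (hη2 : η ≤ 2) (hL : ∀ i ∈ L, w i ≤ η) (j : ℕ) :
    ∑ v : Fin (j + 1) → Bool, (if NoAdj v then wordWt w v else 0)
      ≤ 5 * ((14 + η) / 16 : ℝ) ^ (L.filter fun i => 1 ≤ i ∧ i ≤ j).card * 2 ^ j := by
  rw [total_eq]
  set d := (L.filter fun i => 1 ≤ i ∧ i ≤ j).card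
  have hq := qf_endSum_le_gen w hw0 hw2 L hη0 hη2 hL j
  have hS := sq_add_le_qf (endSum w j true) (endSum w j false)
  apply le_of_sq_le (by positivity)
  have hτρ : ((6 + η) / 8 : ℝ) ≤ ((14 + η) / 16) ^ 2 := by nlinarith [sq_nonneg (2 - η)]
  have hτd : ((6 + η) / 8 : ℝ) ^ d ≤ (((14 + η) / 16 : ℝ) ^ 2) ^ d := pow_le_pow_left₀ (by positivity) hτρ d
  have h4 : (4 : ℝ) ^ j = (2 ^ j) ^ 2 := by rw [← pow_mul, mul_comm, pow_mul]; norm_num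
  have hρ : (((14 + η) / 16 : ℝ) ^ 2) ^ d = (((14 + η) / 16 : ℝ) ^ d) ^ 2 := by rw [← pow_mul, ← pow_mul, mul_comm]
  have h4j : (0 : ℝ) ≤ 4 ^ j := by positivity
  calc (endSum w j true + endSum w j false) ^ 2 ≤ 17 * 4 ^ j * ((6 + η) / 8 : ℝ) ^ d := hS.trans hq
    _ ≤ 25 * 4 ^ j * (((14 + η) / 16 : ℝ) ^ 2) ^ d := by gcongr; norm_num
    _ = (5 * ((14 + η) / 16 : ℝ) ^ d * 2 ^ j) ^ 2 := by rw [h4, hρ]; ring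

end AffBells22

end Summit.QuantumAdvantage.AdviceFreeQNC0
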